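import Summits.QuantumAdvantage.QuantumAdvantage.Theorems.WalkThreeStepProfile

/-!
# Rung (G♯₂) `ThreeStepFreeRungFive` (item stmt-QuantumAdvantage-23286), architecture (U), module U-d 4/5: ADJACENT TRANSPOSITIONS
# CONNECT EQUAL-WEIGHT PATTERNS (generic)

Cell qa-qnc0, route OddPrimeWalk, support item stmt-QuantumAdvantage-23286; prover qn-prover-3 g16.  Generic combinatorics, no
strategy in sight: **`swap_connect`** — a function of `{0,1}ⁿ` invariant under the adjacent transpositions `cornerFlip n k` for
`a < k < b` (swapping coordinates `k − 1, k`) takes the same value on two inputs that agree outside the index block `[a, b)` and have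
the same number of ones inside (`cnt`).  Proof by bubbling (`bubble x j d` applies the transpositions at `j+1, …, j+d`, moving the bit
at `j` up to `j + d`; `bubble_spec`, `bubble_inv`, `cnt_bubble`) and induction on `b`.  Used in 5/5 to identify the register of a
block of weight `w + p` with that of a two-block input of the same weight.
WHAT THIS IS NOT: no game content; separation NOT moved.
-/

namespace Summit.QuantumAdvantage.AdviceFreeQNC0.LocalEngine

open Finset Classical

namespace RungU

variable {n : ℕ}

/-! ### §1 Adjacent transpositions connect the patterns of equal weight (generic) -/

/-- ones of `u` in `[a, b)`. -/
noncomputable def cnt (u : Fin n → Bool) (a b : ℕ) : ℕ :=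
  (univ.filter fun i : Fin n => a ≤ i.val ∧ i.val < b ∧ u i = true).card

/-- `cnt` grows by the new bit. -/
theorem cnt_succ (u : Fin n → Bool) {a b : ℕ} (hab : a ≤ b) (hb : b < n) :
    cnt u a (b + 1) = cnt u a b + (if u ⟨b, hb⟩ = true then 1 else 0) := by
  have h1 := card_band_eq u hab
  have h2 := card_band_eq u (show a ≤ b + 1 by omega)
  have h3 := Coset21.wtPrefix_succ u b hb
  unfold cnt
  omega

/-- beyond `n` the count does not grow. -/
theorem cnt_succ_of_le (u : Fin n → Bool) {a b : ℕ} (hab : a ≤ b) (hb : n ≤ b) : cnt u a (b + 1) = cnt u a b := by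
  have h1 := card_band_eq u hab
  have h2 := card_band_eq u (show a ≤ b + 1 by omega)
  have h3 : wtPrefix u (b + 1) = wtPrefix u b := by
    rw [wtPrefix_min u (b + 1), wtPrefix_min u b, min_eq_right hb, min_eq_right (by omega)]
  unfold cnt
  omega

/-- a transposition with both indices inside `[a, b)` preserves the count. -/
theorem cnt_cornerFlip (u : Fin n → Bool) {a b k : ℕ} (h1 : a < k) (h2 : k < b) : cnt (cornerFlip n k u) a b = cnt u a b := by
  have e1 := card_band_eq u (show a ≤ b by omega)
  have e2 := card_band_eq (cornerFlip n k u) (show a ≤ b by omega)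
  have e3 := wtPrefix_cornerFlip k u (show a ≠ k by omega)
  have e4 := wtPrefix_cornerFlip k u (show b ≠ k by omega)
  unfold cnt
  omega

/-- apply the transpositions at `j+1, …, j+d` in turn: the bit at `j` bubbles up to `j + d`. -/
def bubble (x : Fin n → Bool) (j : ℕ) : ℕ → (Fin n → Bool)
  | 0 => x
  | d + 1 => cornerFlip n (j + d + 1) (bubble x j d)

/-- invariance along the bubbling. -/
theorem bubble_inv {β : Type*} (f : (Fin n → Bool) → β) (x : Fin n → Bool) (j lo hi : ℕ)
    (hinv : ∀ k, lo < k → k < hi → ∀ y, f (cornerFlip n k y) = f y) (hlo : lo ≤ j) :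
    ∀ d, j + d < hi → f (bubble x j d) = f x
  | 0 => fun _ => rfl
  | d + 1 => fun h => by
    show f (cornerFlip n (j + d + 1) (bubble x j d)) = f x
    rw [hinv (j + d + 1) (by omega) (by omega), bubble_inv f x j lo hi hinv hlo d (by omega)]

/-- the count on `[a, b)` along the bubbling (all swaps inside). -/
theorem cnt_bubble (x : Fin n → Bool) (j a b : ℕ) (ha : a ≤ j) : ∀ d, j + d < b → cnt (bubble x j d) a b = cnt x a b
  | 0 => fun _ => rfl
  | d + 1 => fun h => by
    show cnt (cornerFlip n (j + d + 1) (bubble x j d)) a b = cnt x a b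
    rw [cnt_cornerFlip _ (by omega) (by omega), cnt_bubble x j a b ha d (by omega)]

/-- the values after bubbling. -/
theorem bubble_spec (x : Fin n → Bool) (j : ℕ) :
    ∀ d, ∀ hd : j + d < n,
      (∀ i : Fin n, i.val < j ∨ j + d < i.val → bubble x j d i = x i) ∧
      bubble x j d ⟨j + d, hd⟩ = x ⟨j, by omega⟩ ∧
      (∀ i : Fin n, j ≤ i.val → ∀ hi : i.val < j + d, bubble x j d i = x ⟨i.val + 1, by omega⟩)
  | 0 => fun hd => ⟨fun i _ => rfl, rfl, fun i h1 h2 => by omega⟩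
  | d + 1 => fun hd => by
    obtain ⟨ih1, ih2, ih3⟩ := bubble_spec x j d (by omega)
    have eτ : j + d + 1 - 1 = j + d := by omega
    refine ⟨?_, ?_, ?_⟩
    · intro i hi
      show cornerFlip n (j + d + 1) (bubble x j d) i = x i
      rw [DensePeel.cornerFlip_apply_of_ne (j + d + 1) _ i (by omega) (by omega)]
      exact ih1 i (by omega)
    · show cornerFlip n (j + d + 1) (bubble x j d) ⟨j + (d + 1), hd⟩ = x ⟨j, by omega⟩
      have e : (⟨j + (d + 1), hd⟩ : Fin n) = ⟨j + d + 1, by omega⟩ := Fin.ext (by simp; omega)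
      rw [e, cornerFlip_apply_right (j + d + 1) _ (by omega) (by omega)]
      have e2 : (⟨j + d + 1 - 1, by omega⟩ : Fin n) = ⟨j + d, by omega⟩ := Fin.ext (by simp)
      rw [e2, ih2]
    · intro i h1 h2
      show cornerFlip n (j + d + 1) (bubble x j d) i = x ⟨i.val + 1, by omega⟩
      by_cases hi : i.val = j + d
      · have ei : i = ⟨j + d + 1 - 1, by clear hi h1 h2; omega⟩ := Fin.ext (by simp; omega)
        subst ei
        rw [cornerFlip_apply_left (j + d + 1) _ (by omega) (by omega)]
        rw [ih1 ⟨j + d + 1, by omega⟩ (by simp)]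
        congr 1
      · rw [DensePeel.cornerFlip_apply_of_ne (j + d + 1) _ i (by omega) (by omega)]
        exact ih3 i h1 (by omega)

/-- **Adjacent transpositions connect equal-weight patterns**: a function invariant under the transpositions at `a < k < b` takes the
same value on inputs that agree outside the index block `[a, b)` and have the same number of ones inside. -/
theorem swap_connect {β : Type*} (f : (Fin n → Bool) → β) (a : ℕ) :
    ∀ b : ℕ, (∀ k, a < k → k < b → ∀ y, f (cornerFlip n k y) = f y) →
      ∀ x x' : Fin n → Bool, (∀ i : Fin n, i.val < a ∨ b ≤ i.val → x i = x' i) → cnt x a b = cnt x' a b → f x = f x' := by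
  intro b
  induction b with
  | zero =>
    intro _ x x' hag _
    have : x = x' := funext fun i => hag i (Or.inr (Nat.zero_le _))
    rw [this]
  | succ b ih =>
    intro hinv x x' hag hcnt
    have hinv' : ∀ k, a < k → k < b → ∀ y, f (cornerFlip n k y) = f y := fun k h1 h2 y => hinv k h1 (by omega) y
    by_cases hba : b < a
    · have : x = x' := funext fun i => hag i (by omega)
      rw [this]
    push Not at hba
    by_cases hbn : n ≤ b
    · apply ih hinv' x x' (fun i hi => hag i (by omega))
      rw [← cnt_succ_of_le x hba hbn, ← cnt_succ_of_le x' hba hbn]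
      exact hcnt
    push Not at hbn
    -- the equal-top-bit case, for later reuse
    have keq : ∀ y y' : Fin n → Bool, (∀ i : Fin n, i.val < a ∨ b + 1 ≤ i.val → y i = y' i) →
        cnt y a (b + 1) = cnt y' a (b + 1) → y ⟨b, hbn⟩ = y' ⟨b, hbn⟩ → f y = f y' := by
      intro y y' hag' hcnt' heq
      apply ih hinv' y y'
      · intro i hi
        rcases hi with hi | hi
        · exact hag' i (Or.inl hi)
        · by_cases hib : i.val = b
          · have e : i = ⟨b, hbn⟩ := Fin.ext hib
            rw [e]; exact heq
          · exact hag' i (Or.inr (by omega))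
      · rw [cnt_succ y hba hbn, cnt_succ y' hba hbn, heq] at hcnt'
        omega
    -- the unequal case with the `true` on the left
    have kne : ∀ y y' : Fin n → Bool, (∀ i : Fin n, i.val < a ∨ b + 1 ≤ i.val → y i = y' i) →
        cnt y a (b + 1) = cnt y' a (b + 1) → y ⟨b, hbn⟩ = true → y' ⟨b, hbn⟩ = false → f y = f y' := by
      intro y y' hag' hcnt' hy hy'
      -- y' has a one somewhere in [a, b)
      have hc : cnt y' a b = cnt y a b + 1 := by
        rw [cnt_succ y hba hbn, cnt_succ y' hba hbn, hy, hy'] at hcnt'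
        simp only [↓reduceIte, Bool.false_eq_true, add_zero] at hcnt'
        omega
      have hpos : 0 < cnt y' a b := by omega
      unfold cnt at hpos
      obtain ⟨i₀, hi₀⟩ := Finset.card_pos.mp hpos
      rw [Finset.mem_filter] at hi₀
      obtain ⟨-, hja, hjb, hj1⟩ := hi₀
      set j := i₀.val with hj
      set y'' := bubble y' j (b - j) with hy''
      have hjd : j + (b - j) = b := by omega
      obtain ⟨s1, s2, s3⟩ := bubble_spec y' j (b - j) (by omega)
      have f1 : f y'' = f y' := bubble_inv f y' j a (b + 1) hinv hja (b - j) (by omega)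
      have htop : y'' ⟨b, hbn⟩ = true := by
        have e : (⟨b, hbn⟩ : Fin n) = ⟨j + (b - j), by omega⟩ := Fin.ext (by simp; omega)
        rw [hy'', e, s2]
        have e2 : (⟨j, by omega⟩ : Fin n) = i₀ := Fin.ext (by simp [hj])
        rw [e2]; exact hj1
      have hag'' : ∀ i : Fin n, i.val < a ∨ b + 1 ≤ i.val → y i = y'' i := by
        intro i hi
        rw [hag' i hi, hy'', s1 i (by omega)]
      have hcnt'' : cnt y a (b + 1) = cnt y'' a (b + 1) := by
        rw [hcnt', hy'', cnt_bubble y' j a (b + 1) hja (b - j) (by omega)]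
      rw [← f1]
      exact keq y y'' hag'' hcnt'' (by rw [hy, htop])
    by_cases heq : x ⟨b, hbn⟩ = x' ⟨b, hbn⟩
    · exact keq x x' hag hcnt heq
    · cases hx : x ⟨b, hbn⟩ <;> cases hx' : x' ⟨b, hbn⟩
      · rw [hx, hx'] at heq; exact absurd rfl heq
      · exact (kne x' x (fun i hi => (hag i hi).symm) hcnt.symm hx' hx).symm
      · exact kne x x' hag hcnt hx hx'
      · rw [hx, hx'] at heq; exact absurd rfl heq


end RungU

end Summit.QuantumAdvantage.AdviceFreeQNC0.LocalEngine
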